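import Summits.QuantumFields.GaugeBoot.DiagonalRPTorusTwoGeometry
import Summits.QuantumFields.GaugeBoot.DiagonalRPTorusTwoHaar
import HarnessLib

/-!
# Diagonal RP on the two-dimensional torus, III: one back-layer plaquette and one swap orbit
(gauge-boot, task L3(δ))

HONEST FRAMING (cell `pub-gaugeboot`, page 1 of every file): the venture produces certified bounds
on lattice expectations at stated coupling, gauge group, dimension and torus size; NOT a mass gap,
NOT a continuum limit, NOT a string tension; NOT Yang–Mills-summit-bearing (barriers
`FixedCouplingUltralocality`, `PerturbativeInvisibility`). This module is part of a small NEGATIVE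
result about which positivity constraints a TORUS certificate may use; it discharges nothing else.

For `DiagonalRPTorusNegativeTwo.lean`: the Boltzmann factor `κ(C_y D_y⁻¹)` of ONE plaquette of the
back layer integrates, against functions of its two transports, like the two-link kernel
`κ(U_a U_{a'}⁻¹)` (`integral_plaquette_reduce`, `integral_plaquette_four`: `∫ κ(CD⁻¹) = c₀`,
`∫ κ(CD⁻¹) g(D) = ∫ κ(CD⁻¹) g(C) = 0` for `∫ g = 0`); for a swap ORBIT `{y₁, y₂}` of the back layer
the twisted pairing gives **`integral_orbit`**:
`∫ κ(C₁D₁⁻¹) κ(C₂D₂⁻¹) (g(C₂) + s g(C₁)) (g(D₁) + s g(D₂)) dπ = s c₀ (Q₁ + Q₂)`,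
`Q_k = ∫ κ(U_a U_{a'}⁻¹) g(U_a) g(U_{a'}) dπ` (its sign is `sign_Q` in
`DiagonalRPTorusTwoDegenerate.lean`). Finally, measurability / bounds / link dependence of
plaquette sums `Σ_{y ∈ S} Re tr ρ(U_y)` and positivity of `∫ exp(f) dπ`. All statements are proved.
-/

open MeasureTheory Complex Finset Function
open scoped ComplexOrder ENNReal

namespace Summit.QuantumFields.GaugeBoot

open Literature.MathematicalPhysics.QuantumFieldTheory
open Literature.RepresentationTheory.CompactGroups

noncomputable section

namespace DiagRPTwo

/-! ## Block integrals: one plaquette of the back layer, and one swap orbit -/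

section Blocks2

variable {L N : ℕ} [NeZero L] {G : Type*} [Group G] [TopologicalSpace G] [IsTopologicalGroup G]
  [CompactSpace G] [MeasurableSpace G] [BorelSpace G] [SecondCountableTopology G]
  (ρ : G →* Matrix (Fin N) (Fin N) ℂ)

omit [NeZero L] [TopologicalSpace G] [IsTopologicalGroup G] [CompactSpace G] [BorelSpace G]
  [SecondCountableTopology G] in
/-- `C_y` is measurable. -/
theorem measurable_cT [MeasurableMul₂ G] (i j : Fin 2) (y : Site 2 L) :
    Measurable fun U : GaugeConfig 2 L G => cT i j U y :=
  (measurable_pi_apply _).mul (measurable_pi_apply _)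

omit [NeZero L] [TopologicalSpace G] [IsTopologicalGroup G] [CompactSpace G] [BorelSpace G]
  [SecondCountableTopology G] in
/-- `D_y` is measurable. -/
theorem measurable_dT [MeasurableMul₂ G] (i j : Fin 2) (y : Site 2 L) :
    Measurable fun U : GaugeConfig 2 L G => dT i j U y :=
  (measurable_pi_apply _).mul (measurable_pi_apply _)

omit [NeZero L] [TopologicalSpace G] [IsTopologicalGroup G] [CompactSpace G] [MeasurableSpace G]
  [BorelSpace G] [SecondCountableTopology G] in
/-- A function of the two transports of the plaquette at `y` depends only on its four links. -/
theorem dependsOn_blk {α : Type*} (i j : Fin 2) (y : Site 2 L) (Φ : G → G → α) :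
    DependsOn (fun U : GaugeConfig 2 L G => Φ (cT i j U y) (dT i j U y))
      (blk i j y : Set (Edge 2 L)) := by
  intro U V h
  have h1 : U (y, i) = V (y, i) := h _ (by simp [blk])
  have h2 : U (y.shift i, j) = V (y.shift i, j) := h _ (by simp [blk])
  have h3 : U (y, j) = V (y, j) := h _ (by simp [blk])
  have h4 : U (y.shift j, i) = V (y.shift j, i) := h _ (by simp [blk])
  simp only [cT, dT, h1, h2, h3, h4]

/-- **Reduction of one back-layer plaquette to the two-link kernel**:
`∫ κ(C_y D_y⁻¹) g₁(C_y) g₂(D_y) dπ = ∫ κ(U_a U_{a'}⁻¹) g₁(U_a) g₂(U_{a'}) dπ`, `a = (y,i)`,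
`a' = (y,j)`. -/
theorem integral_plaquette_reduce (h4 : 4 ≤ L) {i j : Fin 2} (hij : i ≠ j) (hρ : Continuous ρ)
    (β : ℝ) (y : Site 2 L) {g₁ g₂ : G → ℝ} (hg₁ : Measurable g₁) (hg₂ : Measurable g₂) :
    ∫ U, κ ρ β (cT i j U y * (dT i j U y)⁻¹) * (g₁ (cT i j U y) * g₂ (dT i j U y)) ∂(linkMeasure L
        G) =
      ∫ U, κ ρ β (U (y, i) * (U (y, j))⁻¹) * (g₁ (U (y, i)) * g₂ (U (y, j))) ∂(linkMeasure L G) :=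
          by
  have hne1 : ((y.shift i, j) : Edge 2 L) ≠ (y, i) := fun h => hij (Prod.ext_iff.1 h).2.symm
  have hne2 : ((y, j) : Edge 2 L) ≠ (y, i) := fun h => hij (Prod.ext_iff.1 h).2.symm
  have hne3 : ((y.shift j, i) : Edge 2 L) ≠ (y, i) := fun h =>
    shift_ne_self h4 y j (Prod.ext_iff.1 h).1
  have hne4 : ((y.shift j, i) : Edge 2 L) ≠ (y, j) := fun h => hij (Prod.ext_iff.1 h).2
  have hΨ : Measurable fun p : G × G => κ ρ β (p.1 * p.2⁻¹) * (g₁ p.1 * g₂ p.2) :=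
    ((continuous_κ ρ hρ β).measurable.comp (measurable_fst.mul measurable_snd.inv)).mul
      ((hg₁.comp measurable_fst).mul (hg₂.comp measurable_snd))
  exact integral_transport_pair (L := L) (Ψ := fun c d => κ ρ β (c * d⁻¹) * (g₁ c * g₂ d))
    hne1 hne2 hne3 hne4 hΨ

/-- The four block integrals of one back-layer plaquette: with `c₀ = ∫ κ`, `∫ g = 0`,
`∫ κ(C D⁻¹) = c₀`, `∫ κ(C D⁻¹) g(D) = 0`, `∫ κ(C D⁻¹) g(C) = 0`, and `∫ κ(C D⁻¹) g(C) g(D)` is the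
two-link quantity `Q_y`. -/
theorem integral_plaquette_four (h4 : 4 ≤ L) {i j : Fin 2} (hij : i ≠ j) (hρ : Continuous ρ)
    (β : ℝ) (y : Site 2 L) {g : G → ℝ} (hg : Measurable g) (hg0 : ∫ x, g x ∂(haarProbability G) =
        0) :
    ∫ U, κ ρ β (cT i j U y * (dT i j U y)⁻¹) ∂(linkMeasure L G) = ∫ x, κ ρ β x ∂(haarProbability G)
        ∧
    ∫ U, κ ρ β (cT i j U y * (dT i j U y)⁻¹) * g (dT i j U y) ∂(linkMeasure L G) = 0 ∧
    ∫ U, κ ρ β (cT i j U y * (dT i j U y)⁻¹) * g (cT i j U y) ∂(linkMeasure L G) = 0 ∧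
    ∫ U, κ ρ β (cT i j U y * (dT i j U y)⁻¹) * (g (cT i j U y) * g (dT i j U y)) ∂(linkMeasure L G)
        =
      ∫ U, κ ρ β (U (y, i) * (U (y, j))⁻¹) * (g (U (y, i)) * g (U (y, j))) ∂(linkMeasure L G) := by
  have hne : ((y, i) : Edge 2 L) ≠ (y, j) := fun h => hij (Prod.ext_iff.1 h).2
  have hκm : Measurable (κ ρ β) := (continuous_κ ρ hρ β).measurable
  refine ⟨?_, ?_, ?_, integral_plaquette_reduce ρ h4 hij hρ β y hg hg⟩
  · have h := integral_plaquette_reduce ρ h4 hij hρ β y (g₁ := fun _ => (1 : ℝ))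
      (g₂ := fun _ => (1 : ℝ)) measurable_const measurable_const
    simp only [mul_one] at h
    rw [h, integral_kernel hne hκm]
  · have h := integral_plaquette_reduce ρ h4 hij hρ β y (g₁ := fun _ => (1 : ℝ))
      (g₂ := g) measurable_const hg
    simp only [one_mul] at h
    rw [h, integral_kernel_mul_right hne hκm hg, hg0, mul_zero]
  · have h := integral_plaquette_reduce ρ h4 hij hρ β y (g₁ := g)
      (g₂ := fun _ => (1 : ℝ)) hg measurable_const
    simp only [mul_one] at h
    rw [h, integral_kernel_mul_left hne hκm (κ_inv ρ hρ β) hg, hg0, mul_zero]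

/-- **The swap orbit.** For two distinct back-layer sites `y₁, y₂` on the same diagonal layer and
`g` with `∫ g = 0`, `|g| ≤ 1`:
`∫ κ(C₁D₁⁻¹) κ(C₂D₂⁻¹) (g(C₂) + s g(C₁)) (g(D₁) + s g(D₂)) dπ = s c₀ (Q₁ + Q₂)`. -/
theorem integral_orbit (h4 : 4 ≤ L) {i j : Fin 2} (hij : i ≠ j) (hρ : Continuous ρ) (β : ℝ)
    {y₁ y₂ : Site 2 L} (hne : y₁ ≠ y₂) (hk : kd i j y₁ = kd i j y₂) {g : G → ℝ}
    (hg : Measurable g) (hg1 : ∀ x, |g x| ≤ 1) (hg0 : ∫ x, g x ∂(haarProbability G) = 0) (s : ℝ) :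
    ∫ U, κ ρ β (cT i j U y₁ * (dT i j U y₁)⁻¹) * κ ρ β (cT i j U y₂ * (dT i j U y₂)⁻¹) *
        ((g (cT i j U y₂) + s * g (cT i j U y₁)) * (g (dT i j U y₁) + s * g (dT i j U y₂)))
            ∂(linkMeasure L G) =
      s * (∫ x, κ ρ β x ∂(haarProbability G)) *
        (∫ U, κ ρ β (U (y₁, i) * (U (y₁, j))⁻¹) * (g (U (y₁, i)) * g (U (y₁, j))) ∂(linkMeasure L
            G) +
          ∫ U, κ ρ β (U (y₂, i) * (U (y₂, j))⁻¹) * (g (U (y₂, i)) * g (U (y₂, j))) ∂(linkMeasure L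
              G)) := by
  -- notation
  set E : Site 2 L → GaugeConfig 2 L G → ℝ :=
    fun y U => κ ρ β (cT i j U y * (dT i j U y)⁻¹) with hE
  set gC : Site 2 L → GaugeConfig 2 L G → ℝ := fun y U => g (cT i j U y) with hgC
  set gD : Site 2 L → GaugeConfig 2 L G → ℝ := fun y U => g (dT i j U y) with hgD
  obtain ⟨hI0₁, hI1₁, hI1'₁, hI2₁⟩ := integral_plaquette_four ρ h4 hij hρ β y₁ hg hg0
  obtain ⟨hI0₂, hI1₂, hI1'₂, hI2₂⟩ := integral_plaquette_four ρ h4 hij hρ β y₂ hg hg0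
  -- disjointness of the two blocks
  have h10 : (1 : ZMod L) ≠ 0 := by
    intro h0
    have := val_one_of_four_le h4
    rw [h0, ZMod.val_zero] at this
    omega
  have hdisj : Disjoint (blk i j y₁) (blk i j y₂) :=
    disjoint_blk hij hne (by rw [hk]; intro h; exact h10 (by simpa using h.symm))
      (by rw [hk]; intro h; exact h10 (by simpa using h.symm))
  -- measurability and bounds
  have hκm : Measurable (κ ρ β) := (continuous_κ ρ hρ β).measurable
  have hEm : ∀ y, Measurable (E y) := fun y =>
    hκm.comp ((measurable_cT i j y).mul (measurable_dT i j y).inv)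
  have hgCm : ∀ y, Measurable (gC y) := fun y => hg.comp (measurable_cT i j y)
  have hgDm : ∀ y, Measurable (gD y) := fun y => hg.comp (measurable_dT i j y)
  set K : ℝ := Real.exp (|β| * N) with hK
  have hEb : ∀ y U, |E y U| ≤ K := fun y U => abs_κ_le ρ hρ β _
  have hK0 : 0 ≤ K := (abs_nonneg _).trans (hEb y₁ (fun _ => 1))
  -- dependence on blocks
  have hdep : ∀ (y : Site 2 L) (Φ : G → G → ℝ),
      DependsOn (fun U : GaugeConfig 2 L G => Φ (cT i j U y) (dT i j U y)) (blk i j y : Set _) :=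
    fun y Φ => dependsOn_blk i j y Φ
  -- the four products, each split by independence
  have hsplit : ∀ (Φ₁ Φ₂ : G → G → ℝ), Measurable (fun p : G × G => Φ₁ p.1 p.2) →
      Measurable (fun p : G × G => Φ₂ p.1 p.2) →
      ∫ U, Φ₁ (cT i j U y₁) (dT i j U y₁) * Φ₂ (cT i j U y₂) (dT i j U y₂) ∂(linkMeasure L G) =
        (∫ U, Φ₁ (cT i j U y₁) (dT i j U y₁) ∂(linkMeasure L G)) * ∫ U, Φ₂ (cT i j U y₂) (dT i j U
            y₂) ∂(linkMeasure L G) := by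
    intro Φ₁ Φ₂ h₁ h₂
    have hm₁ : Measurable fun U : GaugeConfig 2 L G => Φ₁ (cT i j U y₁) (dT i j U y₁) := by
      have h0 : Measurable fun U : GaugeConfig 2 L G => (cT i j U y₁, dT i j U y₁) :=
        (measurable_cT i j y₁).prodMk (measurable_dT i j y₁)
      simpa only [Function.comp_def] using h₁.comp h0
    have hm₂ : Measurable fun U : GaugeConfig 2 L G => Φ₂ (cT i j U y₂) (dT i j U y₂) := by
      have h0 : Measurable fun U : GaugeConfig 2 L G => (cT i j U y₂, dT i j U y₂) :=
        (measurable_cT i j y₂).prodMk (measurable_dT i j y₂)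
      simpa only [Function.comp_def] using h₂.comp h0
    exact integral_mul_eq_of_dependsOn_real _ _ hdisj hm₁ hm₂ (hdep y₁ Φ₁) (hdep y₂ Φ₂)
  -- measurability on `G × G` of the four shapes
  have hκp : Measurable fun p : G × G => κ ρ β (p.1 * p.2⁻¹) :=
    hκm.comp (measurable_fst.mul measurable_snd.inv)
  have hP0 : Measurable fun p : G × G => κ ρ β (p.1 * p.2⁻¹) := hκp
  have hP1 : Measurable fun p : G × G => κ ρ β (p.1 * p.2⁻¹) * g p.2 :=
    hκp.mul (hg.comp measurable_snd)
  have hP1' : Measurable fun p : G × G => κ ρ β (p.1 * p.2⁻¹) * g p.1 :=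
    hκp.mul (hg.comp measurable_fst)
  have hP2 : Measurable fun p : G × G => κ ρ β (p.1 * p.2⁻¹) * (g p.1 * g p.2) :=
    hκp.mul ((hg.comp measurable_fst).mul (hg.comp measurable_snd))
  -- expand the integrand
  have hexp : ∀ U : GaugeConfig 2 L G,
      E y₁ U * E y₂ U * ((gC y₂ U + s * gC y₁ U) * (gD y₁ U + s * gD y₂ U)) =
        (E y₁ U * gD y₁ U) * (E y₂ U * gC y₂ U) +
        s * ((E y₁ U) * (E y₂ U * (gC y₂ U * gD y₂ U))) +
        s * ((E y₁ U * (gC y₁ U * gD y₁ U)) * E y₂ U) +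
        s * s * ((E y₁ U * gC y₁ U) * (E y₂ U * gD y₂ U)) := fun U => by ring
  -- integrability of the four terms
  have hgb : ∀ y U, |gC y U| ≤ 1 ∧ |gD y U| ≤ 1 := fun y U => ⟨hg1 _, hg1 _⟩
  have hint : ∀ (a b : GaugeConfig 2 L G → ℝ), Measurable a → Measurable b →
      (∀ U, |a U| ≤ K) → (∀ U, |b U| ≤ K) → Integrable (fun U => a U * b U) (linkMeasure L G) := by
    intro a b ha hb hab hbb
    refine integrable_of_abs_le (ha.mul hb) (B := K * K) fun U => ?_
    rw [abs_mul]
    exact mul_le_mul (hab U) (hbb U) (abs_nonneg _) hK0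
  have hb1 : ∀ y U, |E y U * gD y U| ≤ K := fun y U => by
    rw [abs_mul]; exact (mul_le_mul (hEb y U) (hgb y U).2 (abs_nonneg _) hK0).trans (by rw
        [mul_one])
  have hb1' : ∀ y U, |E y U * gC y U| ≤ K := fun y U => by
    rw [abs_mul]; exact (mul_le_mul (hEb y U) (hgb y U).1 (abs_nonneg _) hK0).trans (by rw
        [mul_one])
  have hb2 : ∀ y U, |E y U * (gC y U * gD y U)| ≤ K := fun y U => by
    rw [abs_mul, abs_mul]
    have : |gC y U| * |gD y U| ≤ 1 := by
      calc |gC y U| * |gD y U| ≤ 1 * 1 :=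
            mul_le_mul (hgb y U).1 (hgb y U).2 (abs_nonneg _) zero_le_one
        _ = 1 := one_mul 1
    exact (mul_le_mul (hEb y U) this (mul_nonneg (abs_nonneg _) (abs_nonneg _)) hK0).trans
      (by rw [mul_one])
  have hT1 : Integrable (fun U => (E y₁ U * gD y₁ U) * (E y₂ U * gC y₂ U)) (linkMeasure L G) :=
    hint _ _ ((hEm y₁).mul (hgDm y₁)) ((hEm y₂).mul (hgCm y₂)) (hb1 y₁) (hb1' y₂)
  have hT2 : Integrable (fun U => (E y₁ U) * (E y₂ U * (gC y₂ U * gD y₂ U))) (linkMeasure L G) :=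
    hint _ _ (hEm y₁) ((hEm y₂).mul ((hgCm y₂).mul (hgDm y₂))) (hEb y₁) (hb2 y₂)
  have hT3 : Integrable (fun U => (E y₁ U * (gC y₁ U * gD y₁ U)) * E y₂ U) (linkMeasure L G) :=
    hint _ _ ((hEm y₁).mul ((hgCm y₁).mul (hgDm y₁))) (hEm y₂) (hb2 y₁) (hEb y₂)
  have hT4 : Integrable (fun U => (E y₁ U * gC y₁ U) * (E y₂ U * gD y₂ U)) (linkMeasure L G) :=
    hint _ _ ((hEm y₁).mul (hgCm y₁)) ((hEm y₂).mul (hgDm y₂)) (hb1' y₁) (hb1 y₂)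
  -- integrate
  have hgoal : ∫ U, E y₁ U * E y₂ U * ((gC y₂ U + s * gC y₁ U) * (gD y₁ U + s * gD y₂ U))
      ∂(linkMeasure L G) =
      s * (∫ x, κ ρ β x ∂(haarProbability G)) *
        (∫ U, κ ρ β (U (y₁, i) * (U (y₁, j))⁻¹) * (g (U (y₁, i)) * g (U (y₁, j))) ∂(linkMeasure L
            G) +
          ∫ U, κ ρ β (U (y₂, i) * (U (y₂, j))⁻¹) * (g (U (y₂, i)) * g (U (y₂, j))) ∂(linkMeasure L
              G)) := by
    simp_rw [hexp]
    rw [integral_add, integral_add, integral_add, integral_const_mul, integral_const_mul,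
      integral_const_mul]
    · -- the four products
      have e1 := hsplit (fun c d => κ ρ β (c * d⁻¹) * g d) (fun c d => κ ρ β (c * d⁻¹) * g c) hP1
          hP1'
      have e2 := hsplit (fun c d => κ ρ β (c * d⁻¹)) (fun c d => κ ρ β (c * d⁻¹) * (g c * g d))
        hP0 hP2
      have e3 := hsplit (fun c d => κ ρ β (c * d⁻¹) * (g c * g d)) (fun c d => κ ρ β (c * d⁻¹))
        hP2 hP0
      have e4 := hsplit (fun c d => κ ρ β (c * d⁻¹) * g c) (fun c d => κ ρ β (c * d⁻¹) * g d) hP1'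
          hP1
      simp only [hE, hgC, hgD] at e1 e2 e3 e4 ⊢
      rw [e1, e2, e3, e4, hI1₁, hI1'₂, hI0₁, hI2₂, hI2₁, hI0₂, hI1'₁, hI1₂]
      ring
    · exact hT1
    · exact hT2.const_mul s
    · exact hT1.add (hT2.const_mul s)
    · exact hT3.const_mul s
    · exact (hT1.add (hT2.const_mul s)).add (hT3.const_mul s)
    · exact hT4.const_mul (s * s)
  exact hgoal

end Blocks2

/-! ## Plaquette sums: measurability, bounds, dependence; positivity of exponential integrals -/

section MainHelpers

variable {L N : ℕ} [NeZero L] {G : Type*} [Group G] [TopologicalSpace G] [IsTopologicalGroup G]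
  [CompactSpace G] [MeasurableSpace G] [BorelSpace G] [SecondCountableTopology G]
  (ρ : G →* Matrix (Fin N) (Fin N) ℂ)

omit [NeZero L] [IsTopologicalGroup G] [CompactSpace G] [BorelSpace G] [SecondCountableTopology G]
    in
/-- `r_y` is measurable. -/
theorem measurable_rr [MeasurableMul₂ G] [MeasurableInv G] [OpensMeasurableSpace G]
    (hρ : Continuous ρ) (i j : Fin 2) (y : Site 2 L) :
    Measurable fun U : GaugeConfig 2 L G => rr ρ i j U y :=
  (Complex.continuous_re.comp hρ.matrix_trace).measurable.comp
    ((measurable_cT i j y).mul (measurable_dT i j y).inv)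

omit [NeZero L] [MeasurableSpace G] [BorelSpace G] [SecondCountableTopology G] in
/-- `|r_y| ≤ N`. -/
theorem abs_rr_le (hρ : Continuous ρ) (i j : Fin 2) (U : GaugeConfig 2 L G) (y : Site 2 L) :
    |rr ρ i j U y| ≤ N := by
  have h := CompactGroup.abs_re_trace_le_card ρ hρ (cT i j U y * (dT i j U y)⁻¹)
  rw [Fintype.card_fin] at h
  exact h

omit [NeZero L] [MeasurableSpace G] [BorelSpace G] [SecondCountableTopology G] in
/-- `|Σ_{y ∈ S} r_y| ≤ |S| N`. -/
theorem abs_sum_rr_le (hρ : Continuous ρ) (i j : Fin 2) (S : Finset (Site 2 L))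
    (U : GaugeConfig 2 L G) : |∑ y ∈ S, rr ρ i j U y| ≤ S.card * N := by
  calc |∑ y ∈ S, rr ρ i j U y| ≤ ∑ y ∈ S, |rr ρ i j U y| := Finset.abs_sum_le_sum_abs _ _
    _ ≤ ∑ _y ∈ S, (N : ℝ) := Finset.sum_le_sum fun y _ => abs_rr_le ρ hρ i j U y
    _ = S.card * N := by rw [Finset.sum_const, nsmul_eq_mul]

omit [NeZero L] [TopologicalSpace G] [IsTopologicalGroup G] [CompactSpace G] [MeasurableSpace G]
  [BorelSpace G] [SecondCountableTopology G] in
/-- `Σ_{y ∈ S} r_y` depends only on the links of the plaquettes in `S`. -/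
theorem dependsOn_sum_rr (i j : Fin 2) (S : Finset (Site 2 L)) :
    DependsOn (fun U : GaugeConfig 2 L G => ∑ y ∈ S, rr ρ i j U y)
      (S.biUnion (blk i j) : Set (Edge 2 L)) := by
  intro U V h
  refine Finset.sum_congr rfl fun y hy => ?_
  exact dependsOn_blk i j y (fun c d => ((ρ (c * d⁻¹)).trace).re)
    (fun e he => h e (Finset.mem_biUnion.2 ⟨y, hy, he⟩))

omit [SecondCountableTopology G] in
/-- `∫ e^{f} dπ > 0` for bounded measurable `f`. -/
theorem integral_exp_pos {f : GaugeConfig 2 L G → ℝ} (hf : Measurable f) {B : ℝ}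
    (hB : ∀ U, |f U| ≤ B) : 0 < ∫ U, Real.exp (f U) ∂(linkMeasure L G) := by
  have hint : Integrable (fun U => Real.exp (f U)) (linkMeasure L G) :=
    integrable_of_abs_le hf.exp (B := Real.exp B) fun U => by
      rw [abs_of_pos (Real.exp_pos _), Real.exp_le_exp]
      exact (le_abs_self _).trans (hB U)
  have hlow : ∫ _U, Real.exp (-B) ∂(linkMeasure L G) ≤ ∫ U, Real.exp (f U) ∂(linkMeasure L G) :=
    integral_mono (integrable_const _) hint fun U =>
      Real.exp_le_exp.2 (by linarith [neg_abs_le (f U), hB U])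
  rw [integral_const, smul_eq_mul, probReal_univ, one_mul] at hlow
  exact lt_of_lt_of_le (Real.exp_pos _) hlow

end MainHelpers

end DiagRPTwo

end

end Summit.QuantumFields.GaugeBoot
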